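import Summits.CriticalPhenomena.CardyFormulaZ2.Theorems.CardyBoundaryCoulombGasRectilinearCardyStubKernelWindowLawPart2
import Summits.CriticalPhenomena.CardyFormulaZ2.Theorems.CardyBoundaryCoulombGasBoundaryDefectGaussianRStubTransportPathsPart4
import Summits.CriticalPhenomena.CardyFormulaZ2.Theorems.LagHandOff.Negative.ArcSwap
import HarnessLib

/-!
# Stub B `stub_rowBlocks` of line `excursion-kernel-covariance`, part 3: the closest-arc rule at the
# end of an arc on a straight side
# (crux `RectilinearCardy`, stmt-CriticalPhenomena-5660, route `CardyBoundaryCoulombGas`)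

Continuum geometry of a Jordan domain `D` near a flat boundary point `c = ∂D(t⋆)` carrying a frame
(`Orient`: inside `B(c, r)`, `D̄ = {nrmC o ≥ h}`, `D = {nrmC o > h}`, so `∂D ∩ B(c, r)` is the line
`{nrmC o = h}`), for an arc `A ⊆ ∂D` which, inside the ball, is one of the two half-lines from `c`:

* `rb_zone_criterion` — **the closest-arc rule is decided by the tangential coordinate**: a point
  `p` of `D̄` close to `c` is at least as close to `A` as to `∂D ∖ A` iff its tangential coordinate
  lies on the side of `A` (ties included), and strictly closer to `∂D ∖ A` otherwise (its foot on the
  line is the unique nearest frontier point up to the tie);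
* `rb_arc_right_end`, `rb_arc_left_end` — membership of `∂D(t)` in the arc `∂D([α, β])` for `t` near
  an end is the order of parameters (injectivity of the loop on a period);
* `rb_param_near` — frontier points close to `∂D(t⋆)` have a parameter close to `t⋆` (the tube
  lemma `tp_tube` read contrapositively);
* `rb_T_sign` — the tangential coordinate `T(t) = tngC o (∂D(t))` is strictly monotone, with a sign
  `sT = ±1`, on a parameter interval around `t⋆` mapped into the flat ball;
* `rb_arc_end_frame` — hence, inside a small ball, the arc IS a tangential half-line from its end
  point, in the form consumed by `rb_zone_criterion`.

All [folklore].
-/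

noncomputable section

open Set Metric
open Literature.Probability.RandomPlanarGeometry
open Literature.Probability.LatticeModels (Orient)
open Summit.CriticalPhenomena.CardyFormulaZ2.Cruxes.BoundaryDefectGaussianR.RainbowMonomialsInExcursionKernels
  (tp_injOn_Ico)
open Summit.CriticalPhenomena.CardyFormulaZ2.Theorems.LagHandOff.Negative (exists_int_of_boundary_eq)

namespace Summit.CriticalPhenomena.CardyFormulaZ2.Cruxes.RectilinearCardy.ExcursionKernelCovariance

/-! ### The closest-arc rule near the end of an arc -/

/-- Near a framed flat point the frontier of an open set is the line `{nrmC = h}`. [folklore] -/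
-- adapted from `kwl_mem_frontier_iff_nrmC` (…RectilinearCardyStubKernelWindowLawPart1)
theorem rb_mem_frontier_iff_nrmC {Ω : Set ℂ} (hΩ : IsOpen Ω) {o : Orient} {h r : ℝ} {c : ℂ}
    (hcl : ∀ z, dist z c < r → (z ∈ closure Ω ↔ h ≤ Orient.nrmC o z))
    (hop : ∀ z, dist z c < r → (z ∈ Ω ↔ h < Orient.nrmC o z)) {z : ℂ} (hz : dist z c < r) :
    z ∈ frontier Ω ↔ Orient.nrmC o z = h := by
  rw [hΩ.frontier_eq, Set.mem_sdiff, hcl z hz, hop z hz, not_lt]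
  exact ⟨fun h' => le_antisymm h'.2 h'.1, fun h' => ⟨h'.ge, h'.le⟩⟩

/-- **The closest-arc rule near the end of an arc on a straight side.** Let `Ω` be open with a frame
`(o, h)` on `B(c, r)` (`Ω̄ = {nrmC ≥ h}`, `Ω = {nrmC > h}`), and let `A ⊆ ∂Ω` be, inside
the ball, the tangential half-line `{s · (tngC z - tngC c) ≥ 0}` from `c` (`s = ±1`), with `A` and
`∂Ω ∖ A` nonempty. For a point `p ∈ Ω̄` with `dist p c < r/4` and height `nrmC p - h < r/4` above the
side: if `s · (tngC p - tngC c) ≥ 0` then `infDist p A ≤ infDist p (∂Ω ∖ A)` (the foot of `p` lies on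
`A`), and if `s · (tngC p - tngC c) < 0` then `infDist p (∂Ω ∖ A) < infDist p A` (the foot lies off `A`,
and every point of `A` is farther by Pythagoras). [folklore] -/
theorem rb_zone_criterion {Ω : Set ℂ} (hΩ : IsOpen Ω) {o : Orient} {h r : ℝ} {c : ℂ}
    (hcl : ∀ z, dist z c < r → (z ∈ closure Ω ↔ h ≤ Orient.nrmC o z))
    (hop : ∀ z, dist z c < r → (z ∈ Ω ↔ h < Orient.nrmC o z))
    {A : Set ℂ} (hAf : A ⊆ frontier Ω) (hAne : A.Nonempty) (hCne : (frontier Ω \ A).Nonempty) {s : ℝ}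
    (hs : s = 1 ∨ s = -1)
    (hA : ∀ z ∈ frontier Ω, dist z c < r → (z ∈ A ↔ 0 ≤ s * (Orient.tngC o z - Orient.tngC o c)))
    {p : ℂ} (hp : dist p c < r / 4) (hp0 : h ≤ Orient.nrmC o p) (hp1 : Orient.nrmC o p - h < r / 4) :
    (0 ≤ s * (Orient.tngC o p - Orient.tngC o c) → infDist p A ≤ infDist p (frontier Ω \ A)) ∧
    (s * (Orient.tngC o p - Orient.tngC o c) < 0 → infDist p (frontier Ω \ A) < infDist p A) := by
  set η₀ : ℝ := Orient.nrmC o p - h with hη₀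
  set τ : ℝ := Orient.tngC o p - Orient.tngC o c with hτ
  have hη₀0 : 0 ≤ η₀ := by rw [hη₀]; linarith
  -- the foot of `p` on the side
  set f : ℂ := ((Orient.tngC o p : ℝ) : ℂ) * Orient.e o + ((h : ℝ) : ℂ) * Orient.ν o with hf
  have hpf : dist p f = η₀ := by rw [hf, kwl_dist_foot, abs_of_nonneg hη₀0]
  have hfn : Orient.nrmC o f = h := Orient.nrmC_combo o _ _
  have hft : Orient.tngC o f = Orient.tngC o p := Orient.tngC_combo o _ _
  have hfc : dist f c < r := by
    have := dist_triangle f p c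
    rw [dist_comm f p, hpf] at this
    linarith
  have hffr : f ∈ frontier Ω := (rb_mem_frontier_iff_nrmC hΩ hcl hop hfc).2 hfn
  have hτle : |τ| ≤ dist p c := by
    rw [hτ, ← Orient.tngC_sub, dist_eq_norm]; exact Orient.abs_tngC_le_norm o _
  -- frontier points: far ones are far, near ones are on the line
  have hfar : ∀ z ∈ frontier Ω, r ≤ dist z c → 3 * r / 4 ≤ dist p z := by
    intro z _ hz
    have := dist_triangle z p c
    rw [dist_comm z p] at this
    linarith
  have hline : ∀ z ∈ frontier Ω, dist z c < r → Orient.nrmC o z = h := fun z hz hzc =>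
    (rb_mem_frontier_iff_nrmC hΩ hcl hop hzc).1 hz
  have hnrm_le : ∀ z ∈ frontier Ω, dist z c < r → η₀ ≤ dist p z := by
    intro z hz hzc
    calc η₀ = |Orient.nrmC o p - Orient.nrmC o z| := by rw [hline z hz hzc, hη₀, abs_of_nonneg hη₀0]
      _ ≤ dist p z := kwl_abs_nrmC_sub_le_dist o p z
  constructor
  · -- the foot lies on `A`
    intro hτ0
    have hfA : f ∈ A := (hA f hffr hfc).2 (by rw [hft]; exact hτ0)
    calc infDist p A ≤ dist p f := infDist_le_dist_of_mem hfA
      _ = η₀ := hpf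
      _ ≤ infDist p (frontier Ω \ A) := by
          refine (le_infDist hCne).2 fun z hz => ?_
          by_cases hzc : dist z c < r
          · exact hnrm_le z hz.1 hzc
          · have := hfar z hz.1 (not_lt.1 hzc); linarith
  · -- the foot lies off `A`, and `A` is uniformly farther
    intro hτ0
    have hfA : f ∉ A := fun hfA => by
      have := (hA f hffr hfc).1 hfA
      rw [hft] at this
      linarith
    have hτne : τ ≠ 0 := by
      intro h0; rw [h0, mul_zero] at hτ0; exact lt_irrefl _ hτ0
    have hτsq : 0 < τ ^ 2 := by positivity
    set ℓ : ℝ := Real.sqrt (τ ^ 2 + η₀ ^ 2) with hℓ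
    have hℓη : η₀ < ℓ := by
      rw [hℓ, Real.lt_sqrt hη₀0]
      linarith
    have hℓle : ℓ ≤ |τ| + η₀ := by
      rw [hℓ, Real.sqrt_le_left (by positivity)]
      nlinarith [abs_nonneg τ, sq_abs τ]
    have hℓr : ℓ < r / 2 := by linarith
    have hAfar : ∀ z ∈ A, ℓ ≤ dist p z := by
      intro z hzA
      have hzfr : z ∈ frontier Ω := hAf hzA
      by_cases hzc : dist z c < r
      · have hzn := hline z hzfr hzc
        have hw : 0 ≤ s * (Orient.tngC o z - Orient.tngC o c) := (hA z hzfr hzc).1 hzA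
        have hsq := kwl_dist_sq o p z
        have hkey : τ ^ 2 ≤ (Orient.tngC o p - Orient.tngC o z) ^ 2 := by
          rcases hs with rfl | rfl
          · nlinarith
          · nlinarith
        have hnn : Orient.nrmC o p - Orient.nrmC o z = η₀ := by rw [hzn, hη₀]
        rw [hnn] at hsq
        rw [hℓ]
        calc Real.sqrt (τ ^ 2 + η₀ ^ 2) ≤ Real.sqrt (dist p z ^ 2) :=
              Real.sqrt_le_sqrt (by rw [hsq]; linarith)
          _ = dist p z := Real.sqrt_sq dist_nonneg
      · have := hfar z hzfr (not_lt.1 hzc); linarith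
    calc infDist p (frontier Ω \ A) ≤ dist p f := infDist_le_dist_of_mem ⟨hffr, hfA⟩
      _ = η₀ := hpf
      _ < ℓ := hℓη
      _ ≤ infDist p A := (le_infDist hAne).2 hAfar

/-! ### Parameters near the end of an arc -/

/-- **Membership in an arc near its right end.** For the arc `∂D([α, β])` of parameter length
`≤ 1 - ε` with `α ≤ β - ε`, and a parameter `t` with `|t - β| < ε`: `∂D(t)` lies on the arc iff
`t ≤ β`. [folklore] -/
theorem rb_arc_right_end (D : JordanDomain) {α β ε t : ℝ} (hαβ : α ≤ β - ε) (hlen : β - α ≤ 1 - ε)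
    (ht : |t - β| < ε) :
    D.boundary t ∈ D.boundary '' Icc α β ↔ t ≤ β := by
  rw [abs_lt] at ht
  constructor
  · rintro ⟨t', ht', heq⟩
    obtain ⟨z, hz⟩ := exists_int_of_boundary_eq D heq
    have hz3 : z ≤ -1 ∨ z = 0 ∨ 1 ≤ z := by omega
    rcases hz3 with hz' | hz' | hz'
    · have : (z : ℝ) ≤ -1 := by exact_mod_cast hz'
      linarith [ht'.1]
    · rw [hz', Int.cast_zero, sub_eq_zero] at hz
      rw [← hz]; exact ht'.2
    · have : (1 : ℝ) ≤ z := by exact_mod_cast hz'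
      linarith [ht'.2]
  · intro htβ
    exact ⟨t, ⟨by linarith, htβ⟩, rfl⟩

/-- **Membership in an arc near its left end.** For the arc `∂D([α, β])` of parameter length
`≤ 1 - ε` with `α + ε ≤ β`, and `|t - α| < ε`: `∂D(t)` lies on the arc iff `α ≤ t`. [folklore] -/
theorem rb_arc_left_end (D : JordanDomain) {α β ε t : ℝ} (hαβ : α + ε ≤ β) (hlen : β - α ≤ 1 - ε)
    (ht : |t - α| < ε) :
    D.boundary t ∈ D.boundary '' Icc α β ↔ α ≤ t := by
  rw [abs_lt] at ht
  constructor
  · rintro ⟨t', ht', heq⟩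
    obtain ⟨z, hz⟩ := exists_int_of_boundary_eq D heq
    have hz3 : z ≤ -1 ∨ z = 0 ∨ 1 ≤ z := by omega
    rcases hz3 with hz' | hz' | hz'
    · have : (z : ℝ) ≤ -1 := by exact_mod_cast hz'
      linarith [ht'.1]
    · rw [hz', Int.cast_zero, sub_eq_zero] at hz
      rw [← hz]; exact ht'.1
    · have : (1 : ℝ) ≤ z := by exact_mod_cast hz'
      linarith [ht'.2]
  · intro htα
    exact ⟨t, ⟨htα, by linarith⟩, rfl⟩

/-- **Frontier points close to `∂D(t⋆)` have a parameter close to `t⋆`** (mod `1`): the tube lemma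
`tp_tube` (parameters at distance `≥ ε` from `t⋆ + ℤ` have images at distance `≥ c`) read
contrapositively, with the representative chosen next to `t⋆` by periodicity. [folklore] -/
theorem rb_param_near (D : JordanDomain) {ε c : ℝ}
    (htube : ∀ s t : ℝ, (∀ n : ℤ, ε ≤ |s - t - n|) → c ≤ dist (D.boundary s) (D.boundary t))
    {t₀ : ℝ} {z : ℂ} (hz : z ∈ frontier D.carrier) (hd : dist z (D.boundary t₀) < c) :
    ∃ t, |t - t₀| < ε ∧ D.boundary t = z := by
  rw [← D.range_boundary] at hz
  obtain ⟨s, rfl⟩ := hz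
  have hex : ∃ n : ℤ, |s - t₀ - n| < ε := by
    by_contra hcon
    push Not at hcon
    have := htube s t₀ hcon
    linarith
  obtain ⟨n, hn⟩ := hex
  refine ⟨s - n, by rwa [show s - n - t₀ = s - t₀ - n by ring], ?_⟩
  have := D.periodic_boundary.sub_int_mul_eq n (x := s)
  rwa [mul_one] at this

/-! ### The tangential coordinate along the loop near a flat point -/

/-- **The tangential coordinate is strictly monotone near a flat point.** If the loop maps the
parameters `|t - t⋆| ≤ θ` (`0 < θ`, `2θ < 1`) into a ball about `∂D(t⋆)` on which `D̄ = {nrmC o ≥ h}`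
and `D = {nrmC o > h}`, then `T(t) = tngC o (∂D(t))` is strictly increasing or strictly decreasing
there: there is a sign `sT = ±1` with `sT · (T t' - T t) > 0` for `t < t'` (`T` is continuous and
injective — the points lie on the line `{nrmC = h}` and the loop is injective on a period). [folklore] -/
theorem rb_T_sign (D : JordanDomain) {o : Orient} {h r t₀ θ : ℝ} (hθ : 0 < θ) (hθ1 : 2 * θ < 1)
    (hcl : ∀ z, dist z (D.boundary t₀) < r → (z ∈ closure D.carrier ↔ h ≤ Orient.nrmC o z))
    (hop : ∀ z, dist z (D.boundary t₀) < r → (z ∈ D.carrier ↔ h < Orient.nrmC o z))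
    (hnear : ∀ t, |t - t₀| ≤ θ → dist (D.boundary t) (D.boundary t₀) < r) :
    ∃ sT : ℝ, (sT = 1 ∨ sT = -1) ∧ ∀ t t' : ℝ, |t - t₀| ≤ θ → |t' - t₀| ≤ θ → t < t' →
      0 < sT * (Orient.tngC o (D.boundary t') - Orient.tngC o (D.boundary t)) := by
  set T : ℝ → ℝ := fun t => Orient.tngC o (D.boundary t) with hT
  have hmemI : ∀ t, t ∈ Icc (t₀ - θ) (t₀ + θ) ↔ |t - t₀| ≤ θ := fun t => by
    rw [abs_sub_le_iff, mem_Icc]; constructor <;> intro h' <;> constructor <;> linarith [h'.1, h'.2]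
  have hline : ∀ t, |t - t₀| ≤ θ → Orient.nrmC o (D.boundary t) = h := fun t ht =>
    (rb_mem_frontier_iff_nrmC D.isOpen hcl hop (hnear t ht)).1 (D.boundary_mem_frontier t)
  have hinj : InjOn T (Icc (t₀ - θ) (t₀ + θ)) := by
    intro t ht t' ht' heq
    have hb : D.boundary t = D.boundary t' := by
      rw [kwl_eq_combo_of_nrmC (hline t ((hmemI t).1 ht)), kwl_eq_combo_of_nrmC (hline t' ((hmemI t').1 ht'))]
      simp only [hT] at heq
      rw [heq]
    exact tp_injOn_Ico D (t₀ - θ) ⟨ht.1, by linarith [ht.2]⟩ ⟨ht'.1, by linarith [ht'.2]⟩ hb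
  have hcont : Continuous T := (kwl_continuous_tngC o).comp D.continuous_boundary
  rcases hcont.continuousOn.strictMonoOn_of_injOn_Icc' (by linarith) hinj with hmono | hanti
  · refine ⟨1, Or.inl rfl, fun t t' ht ht' htt' => ?_⟩
    have := hmono ((hmemI t).2 ht) ((hmemI t').2 ht') htt'
    simp only [hT] at this
    linarith
  · refine ⟨-1, Or.inr rfl, fun t t' ht ht' htt' => ?_⟩
    have := hanti ((hmemI t).2 ht) ((hmemI t').2 ht') htt'
    simp only [hT] at this
    linarith

/-- **An arc is a tangential half-line near its RIGHT end.** With the data of `rb_arc_right_end`, a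
sign `sT` of the tangential coordinate on `|t - β| ≤ θ` (`ε ≤ θ`), and frontier points within `ρ` of
`∂D(β)` having parameters within `ε` of `β`: inside `B(∂D(β), ρ)` the arc `∂D([α, β])` is
`{z ∈ ∂D : (-sT) · (tngC z - tngC ∂D(β)) ≥ 0}`. [folklore] -/
theorem rb_arc_end_frame_right (D : JordanDomain) {o : Orient} {α β ε θ ρ sT : ℝ}
    (hαβ : α ≤ β - ε) (hlen : β - α ≤ 1 - ε) (hεθ : ε ≤ θ)
    (hT : ∀ t t' : ℝ, |t - β| ≤ θ → |t' - β| ≤ θ → t < t' →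
      0 < sT * (Orient.tngC o (D.boundary t') - Orient.tngC o (D.boundary t)))
    (hnear : ∀ z ∈ frontier D.carrier, dist z (D.boundary β) < ρ → ∃ t, |t - β| < ε ∧ D.boundary t = z) :
    ∀ z ∈ frontier D.carrier, dist z (D.boundary β) < ρ →
      (z ∈ D.boundary '' Icc α β ↔ 0 ≤ (-sT) * (Orient.tngC o z - Orient.tngC o (D.boundary β))) := by
  intro z hz hzd
  obtain ⟨t, ht, rfl⟩ := hnear z hz hzd
  rw [rb_arc_right_end D hαβ hlen ht]
  have hθ0 : 0 ≤ θ := ((abs_nonneg _).trans ht.le).trans hεθ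
  have hβ : |β - β| ≤ θ := by simpa using hθ0
  have ht' : |t - β| ≤ θ := by linarith [ht.le]
  rcases lt_trichotomy t β with hlt | rfl | hgt
  · have := hT t β ht' hβ hlt
    exact ⟨fun _ => by nlinarith, fun _ => hlt.le⟩
  · simp
  · have := hT β t hβ ht' hgt
    exact ⟨fun h => absurd hgt (not_lt.2 h), fun h => by nlinarith⟩

/-- **An arc is a tangential half-line near its LEFT end.** With the data of `rb_arc_left_end`, a
sign `sT` of the tangential coordinate on `|t - α| ≤ θ`, and frontier points within `ρ` of `∂D(α)`
having parameters within `ε` of `α`: inside `B(∂D(α), ρ)` the arc `∂D([α, β])` is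
`{z ∈ ∂D : sT · (tngC z - tngC ∂D(α)) ≥ 0}`. [folklore] -/
theorem rb_arc_end_frame_left (D : JordanDomain) {o : Orient} {α β ε θ ρ sT : ℝ}
    (hαβ : α + ε ≤ β) (hlen : β - α ≤ 1 - ε) (hεθ : ε ≤ θ)
    (hT : ∀ t t' : ℝ, |t - α| ≤ θ → |t' - α| ≤ θ → t < t' →
      0 < sT * (Orient.tngC o (D.boundary t') - Orient.tngC o (D.boundary t)))
    (hnear : ∀ z ∈ frontier D.carrier, dist z (D.boundary α) < ρ → ∃ t, |t - α| < ε ∧ D.boundary t = z) :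
    ∀ z ∈ frontier D.carrier, dist z (D.boundary α) < ρ →
      (z ∈ D.boundary '' Icc α β ↔ 0 ≤ sT * (Orient.tngC o z - Orient.tngC o (D.boundary α))) := by
  intro z hz hzd
  obtain ⟨t, ht, rfl⟩ := hnear z hz hzd
  rw [rb_arc_left_end D hαβ hlen ht]
  have hθ0 : 0 ≤ θ := ((abs_nonneg _).trans ht.le).trans hεθ
  have hα : |α - α| ≤ θ := by simpa using hθ0
  have ht' : |t - α| ≤ θ := by linarith [ht.le]
  rcases lt_trichotomy t α with hlt | rfl | hgt
  · have := hT t α ht' hα hlt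
    exact ⟨fun h => absurd hlt (not_lt.2 h), fun h => by nlinarith⟩
  · simp
  · have := hT α t hα ht' hgt
    exact ⟨fun _ => by nlinarith, fun _ => hgt.le⟩

end Summit.CriticalPhenomena.CardyFormulaZ2.Cruxes.RectilinearCardy.ExcursionKernelCovariance

end
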